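import Summits.ValiantsHypothesis.ValiantsHypothesis.Theorems.DivisionGapPerDivisionHardStubMatrixSplit

/-!
# Crux `DivisionGap.PerDivisionHard` (stmt-ValiantsHypothesis-5065), line `pair-descent-jss-endpoint`
(v14) — stub `stub_matrixCellSplit`: OABPs in any variable order are cell-split sums

`stub_matrixCellSplit`: if every entry of every matrix of the list `Ms₁` is a polynomial in the
variables `x_e` with `e ∈ Y` (a set of cells), and every entry of every matrix of `Ms₂` one in the
variables with `e ∉ Y`, then the `(s₀, t₀)` entry of `Ms₁.prod * Ms₂.prod` is `Σ_s f_s · g_s` with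
`f_s := Ms₁.prod s₀ s` in the `Y`-variables and `g_s := Ms₂.prod s t₀` in the others.

Proof.  Verbatim the row version `stub_matrixSplit` with the variable set `{e | e ∈ Y}` in place
of `{e | e.1 ∈ A}`: the entry formula is `Matrix.mul_apply`; "every monomial uses only cells in
`S`" is membership in the subalgebra `MvPolynomial.supported ℝ≥0 S`
(`mem_supported_iff_forall_support`), and entries of list products of matrices with entries in a
subsemiring stay in it (`listProd_matrix_apply_mem`).
-/

noncomputable section

-- `Summit.ValiantsHypothesis.ValiantsHypothesis.…` is the tree's mandated single-conjunct layout
-- (Sub = Summit), so the duplicated namespace component is intended.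
set_option linter.dupNamespace false

namespace Summit.ValiantsHypothesis.ValiantsHypothesis.Theorems.DivisionGapPerDivisionHard

open MvPolynomial
open scoped NNReal

/-- **`stub_matrixCellSplit` (registered sub-goal).  OABPs are cell-split sums.**  If every entry
of every matrix of the list `Ms₁` is a polynomial in the variables `x_e` with `e ∈ Y`, and every
entry of every matrix of `Ms₂` one in the variables with `e ∉ Y`, then the `(s₀, t₀)` entry of
`Ms₁.prod * Ms₂.prod` is `Σ_s f_s · g_s` with `f_s := Ms₁.prod s₀ s` in the `Y`-variables and
`g_s := Ms₂.prod s t₀` in the others. [folklore] -/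
theorem stub_matrixCellSplit :
    ∀ (n W : ℕ) (Y : Finset (Fin n × Fin n))
      (Ms₁ Ms₂ : List (Matrix (Fin W) (Fin W) (MvPolynomial (Fin n × Fin n) ℝ≥0))) (s₀ t₀ : Fin W),
      (∀ M ∈ Ms₁, ∀ a b, ∀ mm ∈ (M a b).support, ∀ e ∈ mm.support, e ∈ Y) →
      (∀ M ∈ Ms₂, ∀ a b, ∀ mm ∈ (M a b).support, ∀ e ∈ mm.support, e ∉ Y) →
      ∃ f g : Fin W → MvPolynomial (Fin n × Fin n) ℝ≥0,
        (Ms₁.prod * Ms₂.prod) s₀ t₀ = ∑ s, f s * g s ∧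
        (∀ s, ∀ mm ∈ (f s).support, ∀ e ∈ mm.support, e ∈ Y) ∧
        (∀ s, ∀ mm ∈ (g s).support, ∀ e ∈ mm.support, e ∉ Y) := by
  intro n W Y Ms₁ Ms₂ s₀ t₀ h₁ h₂
  refine ⟨fun s => Ms₁.prod s₀ s, fun s => Ms₂.prod s t₀, Matrix.mul_apply, fun s => ?_,
    fun s => ?_⟩
  · exact (mem_supported_iff_forall_support {e : Fin n × Fin n | e ∈ Y} _).mp
      (listProd_matrix_apply_mem (MvPolynomial.supported ℝ≥0 {e : Fin n × Fin n | e ∈ Y}).toSubsemiring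
        Ms₁ (fun M hM a b => (mem_supported_iff_forall_support _ _).mpr (h₁ M hM a b)) s₀ s)
  · exact (mem_supported_iff_forall_support {e : Fin n × Fin n | e ∉ Y} _).mp
      (listProd_matrix_apply_mem (MvPolynomial.supported ℝ≥0 {e : Fin n × Fin n | e ∉ Y}).toSubsemiring
        Ms₂ (fun M hM a b => (mem_supported_iff_forall_support _ _).mpr (h₂ M hM a b)) s t₀)

end Summit.ValiantsHypothesis.ValiantsHypothesis.Theorems.DivisionGapPerDivisionHard

end
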